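import Summits.QuantumFields.YangMills.Theorems.BalabanUVNodesN15AdjointTransportExp
import Summits.QuantumFields.YangMills.Theorems.BalabanUVNodesN15CurvedGaugeCovariance
import HarnessLib

/-!
# Route «BalabanUVNodes» (cluster K4 «SpineRates»), Track-A DAG node N15 = NE2, BACKGROUND LAYER — THE ADJOINT ACTION IS A HOMOMORPHISM, READ IN COORDINATES: dag-n15-w3
# file 3's gauge action `trGaugeActFwd τ W R` on transporter fields of conjugations IS the LATTICE GAUGE TRANSFORMATION `U_b ↦ u(b₋) U_b u(b₊)⁻¹` of the bond variables,
# its site gauge transformations `W(x) = coordMat e (Ad_{u(x)})` are ORTHOGONAL with `W(x)ᵀ = coordMat e (Ad_{u(x)⁻¹})` for `U(N)`-valued `u`, and «the propagator at the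
# gauge-transformed background is the conjugated propagator» holds with NO orthogonality hypothesis for unitary gauge transformations

Cell `pub-ymgap`, WIDTH SEAT `pub-ymgap-dag-n15-w2` (director-ym №197 ∕ HUMAN RULING D-0149), generation 2, file 5.  `bears_on: R4∕N15 · K3⁷ SpineGivenEndpointR13SepCoPH
(stmt-QuantumFields-20544)`.  Filed `--kind proof --supports stmt-QuantumFields-20544 --as helper` — COUNT-NEUTRAL; theorems only (0 `def`, 0 `sorry`, 0 `instance`; Mathlib's
scoped Frobenius structure on `M_N(ℂ)` as in files 3–4); imports BY NAME this seat's file 4 `…N15AdjointTransportExp` (p596957: `uN_coordMat_conj_orthogonal`,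
`expTrField_ad_eq_coordMat_conj`, `conjTranspose_exp_smul_of_conjTranspose`; through it file 1 p593011, FILE 28, file 5 of n15-w3, the Barriers trace form) and dag-n15-w3's
file 3 `…N15CurvedGaugeCovariance` (p586904: `trGaugeActFwd`, `covLapM_trGaugeAct_inverse`, `mmulOp`); nothing re-declared.

WHY.  n15-w3's file 3 proves that Bałaban's covariant Laplacian (3.50) and the curved species are gauge COVARIANT under a site-wise gauge change acting on transporter
fields by `R_μ(x) ↦ W(x)R_μ(x)W(x + e_μ)ᵀ` and on functions by `M_W`, for an ABSTRACT orthogonal site field `W` (`WWᵀ = WᵀW = 1` displayed) — «every letter of `G(U)` may be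
computed in any gauge, e.g. cube by cube in the local gauge of (3.35)» (its header).  In the programme the gauge transformations are `U(N)`-valued site fields `u` acting on
bond variables by `U_b ↦ u(b₋)U_b u(b₊)⁻¹` ([Balaban1985BackgroundPropagators] (3.35) p. 396: the local gauges; (3.50) p. 400: transports act by the adjoint action).  THIS FILE
identifies the two: with file 4's `exp(η ad_a) = Ad_{exp(ηa)}` the transporter fields are coordinate matrices of conjugations `Ad_{U_b}`, `Ad` is a HOMOMORPHISM
(`Ad_{u,u′} ∘ Ad_{v,v′} = Ad_{uv, v′u′}`), so `W(x)·coordMat e (Ad_{U_b})·W(x + e_μ)ᵀ = coordMat e (Ad_{u(x) U_b u(x+e_μ)ᴴ})` — the action IS the lattice gauge transformation —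
and `W(x) = coordMat e (Ad_{u(x)})` is orthogonal with transpose `coordMat e (Ad_{u(x)ᴴ})` (file 4's isometry route), so file 3's covariance theorems hold for unitary gauge
transformations with their orthogonality hypotheses DISCHARGED.

WHAT: §1 `mulLeftRight_comp_mulLeftRight` ∕ `mulLeftRight_mul_mulLeftRight` ∕ `mulLeftRight_one_one` ∕ `coordMat_mulLeftRight_mul` (the adjoint action is a homomorphism, in
coordinates); §2 `uN_siteGauge_orthogonal` (file 3's `hW`∕`hW'` for `W(x) := coordMat e (Ad_{u(x)})`, `u(x)ᴴu(x) = 1`), ★ `uN_siteGauge_transpose_eq` (`W(x)ᵀ = coordMat e (Ad_{u(x)ᴴ})`: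
the transpose IS the inverse gauge transformation); §3 ★★ `trGaugeActFwd_conj_eq` (file 3's action on `coordMat e (Ad_{U_μ(x)})` = `coordMat e (Ad_{u(x) U_μ(x) u(x+e_μ)ᴴ})` — the
lattice gauge transformation of the bond variables), ★ `trGaugeActFwd_expTrField_ad_eq` (exponential data of a `𝔲(N)`-valued field: the transformed bond variable
`u(x) e^{ηA_μ(x)} u(x+e_μ)ᴴ`); §4 ★★ `covLapM_trGaugeAct_inverse_of_unitary` (file 3's headline «the propagator at the gauge-transformed background is the conjugated propagator»
with `hW`, `hW'` DISCHARGED for unitary site gauge transformations).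

HONEST FRAMING ∕ LIMITS.  Algebra of the adjoint action and one-application knits; identifies the lineage's gauge-action MODEL with the lattice gauge transformation of bond
variables and removes its orthogonality hypotheses for `U(N)`-valued gauge transformations; proves NO estimate; (3.35) p. 396 ∕ (3.50) p. 400 cited as SHAPES (nothing of [B9]
asserted); the η-defects ∕ majorants of `G(U)`, the [B6] gluing, every (3.42)-shaped letter stay displayed where the lineage has them.  NE2⁺ NOT PRINTED ∕ NOT proved for d = 4;
N15 NOT discharged; K3⁷ OPEN, not claimed; counts UNMOVED (typed 28∕28 · discharged 5∕27, A 5∕28); one finite 𝕋⁴ at fixed ε — NOT infinite volume, NOT OS on ℝ⁴, NOT a mass gap,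
NOT Clay; R4 closes the conditional finite-𝕋⁴ rung `BalabanLadder.UV` only.  Restate-immune (no Theses import).
-/

set_option autoImplicit false

noncomputable section
open scoped BigOperators Matrix Matrix.Norms.Frobenius
open Finset NormedSpace

namespace Summit.QuantumFields.YangMills.BalabanUVNodes.N15.CurvedSpecies

open Summit.QuantumFields.YangMills.BalabanUVNodes.N15.MatrixSpecies (Phi0 coordMat basisConst mmulOp)
open Summit.QuantumFields.YangMills.BalabanUVNodes.N15.BackgroundLayer (gaugeTransport coordMat_one covLapM)
open Literature.MathematicalPhysics.QuantumFieldTheory.Balaban1983to89.Beta.AveragingCorrectionJets (adCLM)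
open Literature.Barriers.QuantumFields (traceForm)

/-! ## §1 The adjoint action is a homomorphism (in any normed algebra, and in coordinates) -/

section AdHom

variable {𝔄 : Type} [NormedRing 𝔄] [NormedAlgebra ℝ 𝔄]

/-- `Ad` IS MULTIPLICATIVE: `(X ↦ uXu′) ∘ (X ↦ vXv′) = (X ↦ (uv)X(v′u′))` — composition of conjugations is conjugation by the products (associativity). [folklore] -/
theorem mulLeftRight_comp_mulLeftRight (u u' v v' : 𝔄) :
    (ContinuousLinearMap.mulLeftRight ℝ 𝔄 u u').comp (ContinuousLinearMap.mulLeftRight ℝ 𝔄 v v') = ContinuousLinearMap.mulLeftRight ℝ 𝔄 (u * v) (v' * u') := by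
  ext x
  simp [ContinuousLinearMap.mulLeftRight_apply, mul_assoc]

/-- The same as a product in the operator algebra `𝔄 →L[ℝ] 𝔄`. [folklore] -/
theorem mulLeftRight_mul_mulLeftRight (u u' v v' : 𝔄) :
    ContinuousLinearMap.mulLeftRight ℝ 𝔄 u u' * ContinuousLinearMap.mulLeftRight ℝ 𝔄 v v' = ContinuousLinearMap.mulLeftRight ℝ 𝔄 (u * v) (v' * u') :=
  mulLeftRight_comp_mulLeftRight u u' v v'

/-- `Ad_1 = id`. [folklore] -/
theorem mulLeftRight_one_one : ContinuousLinearMap.mulLeftRight ℝ 𝔄 1 1 = 1 := by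
  ext x; simp [ContinuousLinearMap.mulLeftRight_apply]

variable {ι : Type} [Fintype ι] [DecidableEq ι] (e : 𝔄 ≃L[ℝ] (ι → ℝ))

/-- IN COORDINATES: `coordMat e (Ad_{u,u′}) · coordMat e (Ad_{v,v′}) = coordMat e (Ad_{uv, v′u′})` (n15-w3 file 5's `coordMat_mul`). [folklore] -/
theorem coordMat_mulLeftRight_mul (u u' v v' : 𝔄) :
    coordMat e (ContinuousLinearMap.mulLeftRight ℝ 𝔄 u u') * coordMat e (ContinuousLinearMap.mulLeftRight ℝ 𝔄 v v') =
      coordMat e (ContinuousLinearMap.mulLeftRight ℝ 𝔄 (u * v) (v' * u')) := by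
  rw [← coordMat_mul, mulLeftRight_mul_mulLeftRight]

/-- Conjugations by mutually inverse pairs have mutually inverse coordinate matrices: `u′u = 1`, `vv′ = 1`... in the form used below: `coordMat e (Ad_{u′,u}) · coordMat e (Ad_{u,u′}) = 1`
whenever `u′u = 1`. [folklore] -/
theorem coordMat_mulLeftRight_inv_mul {u u' : 𝔄} (h : u' * u = 1) :
    coordMat e (ContinuousLinearMap.mulLeftRight ℝ 𝔄 u' u) * coordMat e (ContinuousLinearMap.mulLeftRight ℝ 𝔄 u u') = 1 := by
  rw [coordMat_mulLeftRight_mul, h, mulLeftRight_one_one, coordMat_one]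

end AdHom

/-! ## §2 Unitary site gauge transformations in trace-form-orthonormal coordinates: orthogonal, transpose = inverse transformation -/

section SiteGauge

variable {n : Type} [Fintype n] [DecidableEq n] {κ : Type} [Fintype κ] [DecidableEq κ] (e : Matrix n n ℂ ≃L[ℝ] (κ → ℝ)) {X : Type} (u : X → Matrix n n ℂ)

/-- **n15-w3 file 3's SITE-GAUGE HYPOTHESES `hW`, `hW'` INHABITED**: for a `U(N)`-valued site field `u` (`u(x)ᴴu(x) = 1`) the site gauge transformation
`W(x) := coordMat e (Ad_{u(x)}) = coordMat e (X ↦ u(x)Xu(x)ᴴ)` is orthogonal on both sides in trace-form-orthonormal coordinates (file 4 `uN_coordMat_conj_orthogonal`).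
[cite: Balaban1985BackgroundPropagators, (3.35) p.396, (3.50) p.400 (shape: local gauges, adjoint action)] -/
theorem uN_siteGauge_orthogonal (he : ∀ X Y : Matrix n n ℂ, traceForm X Y = e X ⬝ᵥ e Y) (hu : ∀ x, (u x)ᴴ * u x = 1) (x : X) :
    coordMat e (ContinuousLinearMap.mulLeftRight ℝ (Matrix n n ℂ) (u x) (u x)ᴴ) * (coordMat e (ContinuousLinearMap.mulLeftRight ℝ (Matrix n n ℂ) (u x) (u x)ᴴ))ᵀ = 1 ∧
      (coordMat e (ContinuousLinearMap.mulLeftRight ℝ (Matrix n n ℂ) (u x) (u x)ᴴ))ᵀ * coordMat e (ContinuousLinearMap.mulLeftRight ℝ (Matrix n n ℂ) (u x) (u x)ᴴ) = 1 :=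
  ⟨(uN_coordMat_conj_orthogonal e he (hu x)).2, (uN_coordMat_conj_orthogonal e he (hu x)).1⟩

/-- ★ **THE TRANSPOSE IS THE INVERSE GAUGE TRANSFORMATION**: `W(x)ᵀ = coordMat e (Ad_{u(x)ᴴ})` for `u(x)ᴴu(x) = 1` — both are left inverses of the invertible square matrix `W(x)`
(`WᵀW = 1` by §2's orthogonality, `coordMat e (Ad_{uᴴ})·W = 1` by §1). [folklore] -/
theorem uN_siteGauge_transpose_eq (he : ∀ X Y : Matrix n n ℂ, traceForm X Y = e X ⬝ᵥ e Y) (hu : ∀ x, (u x)ᴴ * u x = 1) (x : X) :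
    (coordMat e (ContinuousLinearMap.mulLeftRight ℝ (Matrix n n ℂ) (u x) (u x)ᴴ))ᵀ = coordMat e (ContinuousLinearMap.mulLeftRight ℝ (Matrix n n ℂ) (u x)ᴴ (u x)) := by
  set M := coordMat e (ContinuousLinearMap.mulLeftRight ℝ (Matrix n n ℂ) (u x) (u x)ᴴ) with hM
  set N := coordMat e (ContinuousLinearMap.mulLeftRight ℝ (Matrix n n ℂ) (u x)ᴴ (u x)) with hN
  have hNM : N * M = 1 := coordMat_mulLeftRight_inv_mul e (hu x)
  have hMN : M * N = 1 := mul_eq_one_comm.mp hNM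
  have hTM : Mᵀ * M = 1 := (uN_siteGauge_orthogonal e u he hu x).2
  calc Mᵀ = Mᵀ * (M * N) := by rw [hMN, Matrix.mul_one]
    _ = N := by rw [← Matrix.mul_assoc, hTM, Matrix.one_mul]

end SiteGauge

/-! ## §3 The action on transporter fields IS the lattice gauge transformation of the bond variables -/

section Lattice

variable {n : Type} [Fintype n] [DecidableEq n] {κ : Type} [Fintype κ] [DecidableEq κ] (e : Matrix n n ℂ ≃L[ℝ] (κ → ℝ)) {X J : Type}
  (τ : J → X ≃ X) (u : X → Matrix n n ℂ) (U : J → X → Matrix n n ℂ)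

/-- ★★ **n15-w3 file 3's GAUGE ACTION ON A TRANSPORTER FIELD OF CONJUGATIONS IS THE LATTICE GAUGE TRANSFORMATION OF THE BOND VARIABLES**: for a `U(N)`-valued site field `u` and
bond variables `U_μ(x)` read as `R_μ(x) = coordMat e (Ad_{U_μ(x)})`, `W(x)R_μ(x)W(x + e_μ)ᵀ = coordMat e (Ad_{U′_μ(x)})` with the transformed bond variable
`U′_μ(x) = u(x) U_μ(x) u(x + e_μ)ᴴ` (and `(U′)ᴴ = u(x+e_μ) U_μ(x)ᴴ u(x)ᴴ` in the second slot). [cite: Balaban1985BackgroundPropagators, (3.35) p.396, (3.50) p.400 (shape)] -/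
theorem trGaugeActFwd_conj_eq (he : ∀ X Y : Matrix n n ℂ, traceForm X Y = e X ⬝ᵥ e Y) (hu : ∀ x, (u x)ᴴ * u x = 1) (μ : J) (x : X) :
    trGaugeActFwd τ (fun x => coordMat e (ContinuousLinearMap.mulLeftRight ℝ (Matrix n n ℂ) (u x) (u x)ᴴ))
        (fun μ x => coordMat e (ContinuousLinearMap.mulLeftRight ℝ (Matrix n n ℂ) (U μ x) (U μ x)ᴴ)) μ x =
      coordMat e (ContinuousLinearMap.mulLeftRight ℝ (Matrix n n ℂ) (u x * U μ x * (u (τ μ x))ᴴ) (u x * U μ x * (u (τ μ x))ᴴ)ᴴ) := by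
  simp only [trGaugeActFwd]
  rw [uN_siteGauge_transpose_eq e u he hu (τ μ x), coordMat_mulLeftRight_mul, coordMat_mulLeftRight_mul, Matrix.conjTranspose_mul, Matrix.conjTranspose_mul,
    Matrix.conjTranspose_conjTranspose]

variable (η : ℝ) (A : J → X → Matrix n n ℂ)

/-- ★ **EXPONENTIAL DATA OF A `𝔲(N)`-VALUED FIELD UNDER A UNITARY GAUGE CHANGE**: file 3's action on n15-w3's transporter field `expTrField e η (ad ∘ A)` (= FILE 28's forward
`U ≡ 1` transport) is the coordinate matrix of `Ad` of the TRANSFORMED BOND VARIABLE `u(x) e^{ηA_μ(x)} u(x + e_μ)ᴴ` (file 4 `expTrField_ad_eq_coordMat_conj`,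
`conjTranspose_exp_smul_of_conjTranspose`). [cite: Balaban1985BackgroundPropagators, (3.35) p.396, (3.37) p.396, (3.50) p.400 (shape)] -/
theorem trGaugeActFwd_expTrField_ad_eq (he : ∀ X Y : Matrix n n ℂ, traceForm X Y = e X ⬝ᵥ e Y) (hu : ∀ x, (u x)ᴴ * u x = 1) (hA : ∀ μ x, (A μ x)ᴴ = -A μ x)
    (μ : J) (x : X) :
    trGaugeActFwd τ (fun x => coordMat e (ContinuousLinearMap.mulLeftRight ℝ (Matrix n n ℂ) (u x) (u x)ᴴ)) (expTrField e η (fun μ x => adCLM ℝ (A μ x))) μ x =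
      coordMat e (ContinuousLinearMap.mulLeftRight ℝ (Matrix n n ℂ) (u x * exp (η • A μ x) * (u (τ μ x))ᴴ) (u x * exp (η • A μ x) * (u (τ μ x))ᴴ)ᴴ) := by
  have hexp : expTrField e η (fun μ x => adCLM ℝ (A μ x)) =
      fun μ x => coordMat e (ContinuousLinearMap.mulLeftRight ℝ (Matrix n n ℂ) (exp (η • A μ x)) (exp (η • A μ x))ᴴ) := by
    funext μ x
    rw [conjTranspose_exp_smul_of_conjTranspose (hA μ x)]
    exact expTrField_ad_eq_coordMat_conj e η (fun μ x => A μ x) μ x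
  rw [hexp]
  exact trGaugeActFwd_conj_eq e τ u (fun μ x => exp (η • A μ x)) he hu μ x

end Lattice

/-! ## §4 «The propagator at the gauge-transformed background is the conjugated propagator» for unitary gauge transformations -/

section Propagator

variable {n : Type} [Fintype n] [DecidableEq n] {κ : Type} [Fintype κ] [DecidableEq κ] (e : Matrix n n ℂ ≃L[ℝ] (κ → ℝ)) {X J : Type} [Fintype J]
  (η : ℝ) (τ : J → X ≃ X) (u : X → Matrix n n ℂ) (R : J → X → Matrix κ κ ℝ)

/-- ★★ **n15-w3 file 3's HEADLINE WITH `hW`, `hW'` DISCHARGED**: for a `U(N)`-valued site field `u` and `W(x) := coordMat e (Ad_{u(x)})` in trace-form-orthonormal coordinates, if `G`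
is a left inverse of `covLapM τ η (gaugePair τ R) + P` then `M_W G M_{Wᵀ}` is a left inverse of `covLapM τ η (gaugePair τ R^W) + M_W P M_{Wᵀ}` — ONE application of
`covLapM_trGaugeAct_inverse` (p586904) with the two orthogonality hypotheses supplied by `uN_siteGauge_orthogonal`. [cite: Balaban1985BackgroundPropagators, (3.35) p.396, (3.50) p.400 (shapes)] -/
theorem covLapM_trGaugeAct_inverse_of_unitary (he : ∀ X Y : Matrix n n ℂ, traceForm X Y = e X ⬝ᵥ e Y) (hu : ∀ x, (u x)ᴴ * u x = 1)
    {P G : (X × κ → ℝ) →ₗ[ℝ] (X × κ → ℝ)} (hG : (covLapM τ η (gaugePair τ R) + P) ∘ₗ G = LinearMap.id) :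
    (covLapM τ η (gaugePair τ (trGaugeActFwd τ (fun x => coordMat e (ContinuousLinearMap.mulLeftRight ℝ (Matrix n n ℂ) (u x) (u x)ᴴ)) R)) +
        mmulOp (fun x => coordMat e (ContinuousLinearMap.mulLeftRight ℝ (Matrix n n ℂ) (u x) (u x)ᴴ)) ∘ₗ P ∘ₗ
          mmulOp (fun x => (coordMat e (ContinuousLinearMap.mulLeftRight ℝ (Matrix n n ℂ) (u x) (u x)ᴴ))ᵀ)) ∘ₗ
      (mmulOp (fun x => coordMat e (ContinuousLinearMap.mulLeftRight ℝ (Matrix n n ℂ) (u x) (u x)ᴴ)) ∘ₗ G ∘ₗ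
        mmulOp (fun x => (coordMat e (ContinuousLinearMap.mulLeftRight ℝ (Matrix n n ℂ) (u x) (u x)ᴴ))ᵀ)) = LinearMap.id :=
  covLapM_trGaugeAct_inverse η τ _ R (fun x => (uN_siteGauge_orthogonal e u he hu x).1) (fun x => (uN_siteGauge_orthogonal e u he hu x).2) hG

end Propagator

end Summit.QuantumFields.YangMills.BalabanUVNodes.N15.CurvedSpecies

end
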